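import Mathlib
import HarnessLib
import Summits.HubbardSuperconductivity.HubbardSuperconductivity.Theorems.KLProgrammeKLRegimeSplitEngineV4

/-!
# Route `KLProgramme` — crux K3 `KLRegimeTwoPointLimit` (stmt-HubbardSuperconductivity-19937): the VALUE clauses of the split at the
# single spin pattern `(↑,↓) = (0,1)` (Δ-spin), over p1's `…SplitEngineV4`

Cell gate-hubbard-kl, seat p1b (child-1 co-owner; g3).  Text: HOME/STATUS p1b 2026-08-26T12:5xZ «Δ11 (spin)»; HOME/prover-p1b/GAINS-NOTE.md §6.

WHY.  V3/V4 state the running-coupling VALUE clauses — (E2′) `QuarticValueIncrementAt(V4)`, its UV clause `QuarticValueUVAt`, the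
hypothesis of (E5) `IsoTupleL1At`, and child 1's value line `QuarticValueLine` — for ALL spin pairs `σ σ'`.  But the only pair-class
supplier, (B1-v2) `PairArrayAt`, is the `↑↓` pair array (`klPairAmplitude`), and inside the pair class `GeoConsts.WF` leaves the pp gain
free (its Ioc-clause starts above the tuple's own class), so at EQUAL spins `σ = σ'` in the pair class NO hypothesis of child 1 bounds
`klQuarticValue … n σ σ …` by `O(U)` (summing (E2′) gives `Klam²U²·n = O(c)`): child 1 is unprovable as cut there, although the statement
is true — by the `SU(2)` structure of the vertex (the s-wave part is a singlet; BGM 2006 (2.25) writes ONE spin-independent `λ`).  Remedy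
(the engine proves the model's symmetries anyway, cf. (E0)): state every VALUE clause at the one pattern `(0,1)`; child 1 closes it from
`PairArrayAt` in the pair class (`klQuarticValue … n 0 1 k₁ k₂ k₃` is an even leg permutation of `klPairAmplitude … n (k₁+k₃) k₂ k₁`) and
from the frozen sums outside it; the engine derives the other spin patterns by `SU(2)` and spin flip INSIDE child 3.

CONTENT (new names, append-only; for p2 g4's bundle): `QuarticValueIncrementAtS` (= p1's `QuarticValueIncrementAtV4` at `(0,1)`),
`QuarticValueUVAtS`, `IsoTupleL1AtS` (hypothesis at `(0,1)`), `QuarticValueLineS`, `EndpointLineS`, `EngineBoundsAtV4S`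
(= `EngineBoundsAtV4` with the three S-clauses), `BetaSplitAtS := PairArrayAt ∧ EndpointLineS ∧ FirstMoments` (SPLIT SLOT CHANGED vs V3:
weakened), and the implications from V3/V4 (`…S_of_…`).  Definitions with bodies; nothing is asserted about the model.
-/

noncomputable section

namespace Summit.HubbardSuperconductivity.HubbardSuperconductivity.Theorems.KLRegimeSplit

set_option linter.dupNamespace false -- summit = problem name (single-conjunct summit), D-0017

open Real Finset Literature.MathematicalPhysics.QuantumLattice Literature.Probability.LatticeModels
open Summit.HubbardSuperconductivity.HubbardSuperconductivity.Theorems.KLProgrammeLegKernels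

section Model

variable (L M : ℕ) [NeZero L] [NeZero M]

/-- **(E2′-S) pointwise increments of the `↑↓` running coupling values at the TRUE transfers** (p1's (E2′-v4) at spins `(0,1)`): at
`n ≥ 1`, for all momenta of the ball, `|λ_n^{↑↓}(k₁,k₂,k₃) − λ_{n-1}^{↑↓}(k₁,k₂,k₃)| ≤ gainBar + ē_{n-1} + thermalBar + legDressBar·legSliceCount`. -/
def QuarticValueIncrementAtS (G : GeoConsts) (P : SplitConsts) (Q : EngConsts) (β U μ : ℝ) (K : TrigPolyC4v) (n : ℕ) : Prop :=
  1 ≤ n → ∀ k₁ ∈ klBall L μ K, ∀ k₂ ∈ klBall L μ K, ∀ k₃ ∈ klBall L μ K,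
    ‖klQuarticValue L M β U μ K n 0 1 k₁ k₂ k₃ - klQuarticValue L M β U μ K (n - 1) 0 1 k₁ k₂ k₃‖ ≤
      gainBar G P U n (klTorusNorm L (k₁ + k₃)) (klTorusNorm L (k₁ - k₂)) (klTorusNorm L (k₂ - k₃)) +
        eremBar G P Q U β L (n - 1) + thermalBar G P U β n +
          legDressBar G P U (legSliceCount L μ K n ![k₁, k₂, k₃, k₁ - k₂ + k₃])

/-- **(E2′-S, n = 0) the ultraviolet size of the `↑↓` running coupling values**: `|λ₀^{↑↓}(k₁,k₂,k₃)| ≤ |U| + initDevBar` on the ball. -/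
def QuarticValueUVAtS (G : GeoConsts) (β U μ : ℝ) (K : TrigPolyC4v) (n : ℕ) : Prop :=
  n = 0 → ∀ k₁ ∈ klBall L μ K, ∀ k₂ ∈ klBall L μ K, ∀ k₃ ∈ klBall L μ K,
    ‖klQuarticValue L M β U μ K 0 0 1 k₁ k₂ k₃‖ ≤ |U| + initDevBar G U

/-- **(E5-S) `↑↓` values ⇒ fixed-tuple `L¹` on ISOTROPIC tuples of every class** (implication form, hypothesis at spins `(0,1)` only — a
STRONGER engine clause than (E5-v3); the engine recovers the other spin patterns by `SU(2)`). -/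
def IsoTupleL1AtS (G : GeoConsts) (P : SplitConsts) (β U μ : ℝ) (K : TrigPolyC4v) (n : ℕ) : Prop :=
  ∀ B : ℝ, 0 ≤ B →
    (∀ k₁ ∈ klBall L μ K, ∀ k₂ ∈ klBall L μ K, ∀ k₃ ∈ klBall L μ K, ‖klQuarticValue L M β U μ K n 0 1 k₁ k₂ k₃‖ ≤ B) →
      ∀ m : ℕ, n ≤ m → ∀ Ω ∈ bgmSectorSet L M (klIsoFamily L M β μ K klE0 m) 4, ∀ x₁ : SpaceTimeIdx L M,
        fixedTupleL1 L M β 3 (klIsoKernelAt L M β U μ K n m) Ω x₁ ≤ G.CF * B + G.CF * (P.Klam * U) ^ 2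

/-- **`QuarticValueLineS n`** — child 1's value-level endpoint line at spins `(0,1)`: `|λ_n^{↑↓}(k₁,k₂,k₃)| ≤ Klam·|U|` on the ball. -/
def QuarticValueLineS (P : SplitConsts) (β U μ : ℝ) (K : TrigPolyC4v) (n : ℕ) : Prop :=
  ∀ k₁ ∈ klBall L μ K, ∀ k₂ ∈ klBall L μ K, ∀ k₃ ∈ klBall L μ K, ‖klQuarticValue L M β U μ K n 0 1 k₁ k₂ k₃‖ ≤ P.Klam * |U|

/-- **`EndpointLineS`** = the ISOTROPIC endpoint norm line ∧ the `↑↓` VALUE line. -/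
def EndpointLineS (P : SplitConsts) (β U μ : ℝ) (K : TrigPolyC4v) (n : ℕ) : Prop :=
  EndpointNormLineIso L M P β U μ K n ∧ QuarticValueLineS L M P β U μ K n

/-- **`EngineBoundsAtV4S … G P Q K n`** = p1's `EngineBoundsAtV4` with the three value clauses at spins `(0,1)`:
(E0) ∧ (E1-v4) ∧ (E2-v4) ∧ (E2″-v4) ∧ (E2′-S + UV-S) ∧ (E4) ∧ (E5-S).  Same slot type as `Preds.engine`. -/
def EngineBoundsAtV4S (G : GeoConsts) (P : SplitConsts) (Q : EngConsts) (β U μ : ℝ) (K : TrigPolyC4v) (n : ℕ) : Prop :=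
  SelfEnergySymmetric L M β U μ K n ∧ KernelNormsV4 L M P Q β U μ K n ∧
    PairLadderStepAtV4 L M G P Q β U μ K n ∧ PairValueIncrementAtV4 L M G P Q β U μ K n ∧
      QuarticValueIncrementAtS L M G P Q β U μ K n ∧ QuarticValueUVAtS L M G β U μ K n ∧
        EngineFirstMoments L M G P Q β U μ K n ∧ IsoTupleL1AtS L M G P β U μ K n

/-- **`BetaSplitAtS … G P Q K n`** := `PairArrayAt ∧ EndpointLineS ∧ FirstMoments` ((B1-v2), (B2-S), (B4)).  Same slot type as
`Preds.split`; `G`, `Q` are not read.  Weaker than `BetaSplitAtV3` (`betaSplitAtS_of_V3`). -/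
def BetaSplitAtS (_G : GeoConsts) (P : SplitConsts) (_Q : EngConsts) (β U μ : ℝ) (K : TrigPolyC4v) (n : ℕ) : Prop :=
  PairArrayAt L M P β U μ K n ∧ EndpointLineS L M P β U μ K n ∧ FirstMoments L M P β U μ K n

/-! ## Bookkeeping: relations to V3 / V4 -/

/-- (E2′-v4) implies (E2′-S) (one spin pattern of it). -/
theorem quarticValueIncrementAtS_of_V4 (G : GeoConsts) (P : SplitConsts) (Q : EngConsts) (β U μ : ℝ) (K : TrigPolyC4v) (n : ℕ)
    (h : QuarticValueIncrementAtV4 L M G P Q β U μ K n) : QuarticValueIncrementAtS L M G P Q β U μ K n :=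
  fun hn k₁ hk₁ k₂ hk₂ k₃ hk₃ => h hn 0 1 k₁ hk₁ k₂ hk₂ k₃ hk₃

/-- (E2′-v3, UV) implies (E2′-S, UV). -/
theorem quarticValueUVAtS_of_V3 (G : GeoConsts) (β U μ : ℝ) (K : TrigPolyC4v) (n : ℕ) (h : QuarticValueUVAt L M G β U μ K n) :
    QuarticValueUVAtS L M G β U μ K n :=
  fun hn k₁ hk₁ k₂ hk₂ k₃ hk₃ => h hn 0 1 k₁ hk₁ k₂ hk₂ k₃ hk₃

/-- V3's value line implies the `(0,1)` value line. -/
theorem quarticValueLineS_of_V3 (P : SplitConsts) (β U μ : ℝ) (K : TrigPolyC4v) (n : ℕ) (h : QuarticValueLine L M P β U μ K n) :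
    QuarticValueLineS L M P β U μ K n :=
  fun k₁ hk₁ k₂ hk₂ k₃ hk₃ => h 0 1 k₁ hk₁ k₂ hk₂ k₃ hk₃

/-- `BetaSplitAtV3` implies `BetaSplitAtS` (the split slot is WEAKENED only). -/
theorem betaSplitAtS_of_V3 (G : GeoConsts) (P : SplitConsts) (Q : EngConsts) (β U μ : ℝ) (K : TrigPolyC4v) (n : ℕ)
    (h : BetaSplitAtV3 L M G P Q β U μ K n) : BetaSplitAtS L M G P Q β U μ K n :=
  ⟨h.1, ⟨h.2.1.1, quarticValueLineS_of_V3 L M P β U μ K n h.2.1.2⟩, h.2.2⟩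

/-- (E5-S) implies (E5-v3): a hypothesis on all spin pairs implies the one on `(0,1)`. -/
theorem isoTupleL1At_of_S (G : GeoConsts) (P : SplitConsts) (β U μ : ℝ) (K : TrigPolyC4v) (n : ℕ)
    (h : IsoTupleL1AtS L M G P β U μ K n) : IsoTupleL1At L M G P β U μ K n :=
  fun B hB hval => h B hB fun k₁ hk₁ k₂ hk₂ k₃ hk₃ => hval 0 1 k₁ hk₁ k₂ hk₂ k₃ hk₃

end Model

end Summit.HubbardSuperconductivity.HubbardSuperconductivity.Theorems.KLRegimeSplit

end
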